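import Literature.NumberTheory.PAdicHodge.TateAlmostEtaleGauge
import Literature.NumberTheory.PAdicHodge.CyclotomicTowerPthPowers
import Mathlib.FieldTheory.Galois.Basic
import HarnessLib

/-!
# Tate's almost étale lemma — the cyclotomic stabiliser in a finite Galois layer

Continuation of `TateAlmostEtaleGauge`.  For a finite normal layer `K₀ ⊆ Ω ⊆ F̄` containing a primitive
`p^n`-th root of unity `ζ` (`(ζ : F̄) = CyclotomicTower.zeta F p n`) and `H = Stab_G(ζ)`,
`G = Gal(Ω/K₀)`, we supply the two inputs of the different-free proof of Tate 1967 §3.2 Prop. 9 that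
concern the base `K₀(ζ_{p^n})`:

* §1 `exists_integral_aeval_eq_of_forall_stabilizer` — **`𝒪_{Ω^H} = ℤ_p[ζ − 1]`**: an `H`-fixed
  integer `c ∈ Ω` lies in `K₀(ζ)` (Galois correspondence in `Ω`), hence (the tree's orthogonality of
  the `π`-basis, `CyclotomicTowerPthPowers.norm_coeff_le_one_of_norm_aeval_le_one`: `𝒪_{ℚ_p(ζ)} =
  ℤ_p[ζ]`, Serre IV §4 Prop. 17) `c = s(ζ − 1)` with `s ∈ ℤ_p[X]` — the hypothesis `hgen` of
  `TateAlmostEtale.prod_gauge_le_norm_sub`;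
* §2 `prod_erase_max_norm_sub_le` — the **counting bound** over `G/H ≅ (ℤ/p^n)^×`:
  `∏_{q ∈ G/H, q ≠ 1} max ‖q ζ − ζ‖ ‖ζ_{p^{n−m}} − 1‖ ≤ ‖p‖^{m−1}` (`1 ≤ m ≤ n − 1`): the cosets are
  the conjugates `ζ ξ` of `ζ`, and for `ξ` of order `p^j`, `n − m < j < n`, `‖ζξ − ζ‖ = ‖ζ_{p^j} − 1‖`
  with `∏_{ord ξ = p^j} ‖ζ_{p^j} − 1‖ = ‖ζ_{p^j} − 1‖^{φ(p^j)} = ‖p‖` (`CyclotomicTower.norm_zeta_sub_one_pow`).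
  This is the multiplicative form of "the Herbrand sum `Σ_{a ∈ (ℤ/pⁿ)^×} min(v(ζ^a − ζ), u)` grows
  like `log_p(1/u)`" — the upper ramification breaks of `ℚ_p(ζ_{p^n})/ℚ_p` are `1, 2, …, n − 1`
  (Serre IV §4 Prop. 18), here without Herbrand functions.

References: J.-P. Serre, *Local Fields*, Ch. IV §4 Prop. 17–18 [SerreLocalFields1979]; J. Tate,
*p-divisible groups* (1967) §3.1–3.2 [Tate1967].
-/

noncomputable section

open scoped Classical
open Polynomial Finset IntermediateField

namespace Literature.NumberTheory.PAdicHodge.TateAlmostEtale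

open ValuativeRel CyclotomicTower
open Literature.NumberTheory.GaloisRepresentations
open Literature.NumberTheory.GaloisRepresentations.IsNonarchimedeanLocalField

variable {F : Type} [Field F] [ValuativeRel F] [TopologicalSpace F] [IsNonarchimedeanLocalField F]
  [CharZero F] {p : ℕ} [Fact p.Prime] (hp : valuation F p < 1)
variable (Ω : IntermediateField (PadicBase F p hp) (NormedAlgClosure F))
  [FiniteDimensional (PadicBase F p hp) Ω] [Normal (PadicBase F p hp) Ω]

/-! ## §1 `H`-fixed integers are in `ℤ_p[ζ − 1]` -/

/-- An element of `Ω` fixed by the stabiliser of `ζ` in `Gal(Ω/K₀)` lies in `K₀(ζ) = K n` (finite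
Galois correspondence in `Ω`, transported to `F̄`).
[cite: SerreLocalFields1979, Ch. IV §4 (the field ℚ_p(ζ_{p^n}) as a fixed field)] -/
theorem coe_mem_K_of_forall_stabilizer {n : ℕ} {ζΩ : Ω}
    (hζ : (ζΩ : NormedAlgClosure F) = zeta F p n) {c : Ω}
    (hc : ∀ h : Ω ≃ₐ[PadicBase F p hp] Ω, h ζΩ = ζΩ → h c = c) :
    (c : NormedAlgClosure F) ∈ K hp n := by
  haveI : IsGalois (PadicBase F p hp) Ω := ⟨⟩
  set L : IntermediateField (PadicBase F p hp) Ω := (PadicBase F p hp)⟮ζΩ⟯ with hL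
  have h1 : c ∈ IntermediateField.fixedField L.fixingSubgroup := by
    rw [IntermediateField.mem_fixedField_iff]
    intro f hf
    exact hc f ((IntermediateField.mem_fixingSubgroup_iff L f).mp hf ζΩ
      (IntermediateField.mem_adjoin_simple_self _ ζΩ))
  rw [IsGalois.fixedField_fixingSubgroup] at h1
  have h2 : (c : NormedAlgClosure F) ∈ L.map Ω.val := ⟨c, h1, rfl⟩
  rw [hL, IntermediateField.adjoin_map, Set.image_singleton] at h2
  rw [K_def, ← hζ]
  exact h2

/-- **`𝒪_{Ω^H} = ℤ_p[ζ − 1]`**: an integral element of `Ω` fixed by the stabiliser `H` of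
`ζ = ζ_{p^n}` (`n ≥ 1`) is `s(ζ − 1)` for a polynomial `s ∈ ℤ_p[X]` (coefficients of norm `≤ 1`) —
the hypothesis `hgen` of `prod_gauge_le_norm_sub`.  Serre IV §4 Prop. 17: `𝒪_{ℚ_p(ζ)} = ℤ_p[ζ]`.
[cite: SerreLocalFields1979, Ch. IV §4 Prop. 17] -/
theorem exists_integral_aeval_eq_of_forall_stabilizer {n : ℕ} (hn : 1 ≤ n) {ζΩ : Ω}
    (hζ : (ζΩ : NormedAlgClosure F) = zeta F p n) (c : Ω)
    (hc : ∀ h ∈ MulAction.stabilizer (Ω ≃ₐ[PadicBase F p hp] Ω) ζΩ, h c = c)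
    (hc1 : ‖(c : NormedAlgClosure F)‖ ≤ 1) :
    ∃ s : (PadicBase F p hp)[X], (∀ j, ‖s.coeff j‖ ≤ 1) ∧ aeval (ζΩ - 1) s = c := by
  have hc' : ∀ h : Ω ≃ₐ[PadicBase F p hp] Ω, h ζΩ = ζΩ → h c = c :=
    fun h hh => hc h (MulAction.mem_stabilizer_iff.mpr hh)
  obtain ⟨s, hs, hsc⟩ := exists_aeval_pi_eq hp (coe_mem_K_of_forall_stabilizer hp Ω hζ hc')
  refine ⟨s, fun j => norm_coeff_le_one_of_norm_aeval_le_one hp hn s hs (by rw [hsc]; exact hc1) j,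
    ?_⟩
  apply Subtype.ext
  rw [← IntermediateField.aeval_coe]
  push_cast
  rw [hζ]
  exact hsc

/-! ## §2 The counting bound over `G/H ≅ (ℤ/pⁿ)^×` -/

/-- `‖ζ_{p^j} − 1‖` is non-decreasing in `j` (`ζ_{p^j}` is a power of `ζ_{p^{j'}}` for `j ≤ j'`).
[cite: SerreLocalFields1979, Ch. IV §4 Prop. 17 (v(ζ_{p^j} − 1) = 1/φ(p^j))] -/
theorem norm_zeta_sub_one_mono {j j' : ℕ} (h : j ≤ j') :
    ‖zeta F p j - 1‖ ≤ ‖zeta F p j' - 1‖ := by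
  obtain ⟨i, hi⟩ := exists_zeta_eq_pow (F := F) (p := p) h
  rw [hi]
  exact norm_pow_sub_one_le (norm_zeta F p j').le i

/-- For `ζ = ζ_{p^n}` and `ξ` a primitive `p^j`-th root of unity with `1 ≤ j < n`, `ζ ξ` is again a
primitive `p^n`-th root of unity. [folklore] -/
private theorem isPrimitiveRoot_zeta_mul {n j : ℕ} (hj : 1 ≤ j) (hjn : j < n)
    {ξ : NormedAlgClosure F} (hξ : IsPrimitiveRoot ξ (p ^ j)) :
    IsPrimitiveRoot (zeta F p n * ξ) (p ^ n) := by
  have hprime : p.Prime := Fact.out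
  haveI : Fact p.Prime := inferInstance
  obtain ⟨n', rfl⟩ : ∃ n', n = n' + 1 := ⟨n - 1, (Nat.sub_add_cancel (hj.trans hjn.le)).symm⟩
  have hξn' : ξ ^ p ^ n' = 1 := by
    obtain ⟨k, hk⟩ := Nat.exists_eq_add_of_le (Nat.lt_succ_iff.mp hjn)
    rw [hk, pow_add, pow_mul, hξ.pow_eq_one, one_pow]
  have h1 : (zeta F p (n' + 1) * ξ) ^ p ^ (n' + 1) = 1 := by
    rw [mul_pow, (zeta_spec F p (n' + 1)).pow_eq_one, one_mul, pow_succ, pow_mul, hξn', one_pow]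
  have h2 : ¬ (zeta F p (n' + 1) * ξ) ^ p ^ n' = 1 := by
    intro h
    rw [mul_pow, hξn', mul_one] at h
    have := (zeta_spec F p (n' + 1)).pow_eq_one_iff_dvd (p ^ n') |>.mp h
    exact absurd (Nat.le_of_dvd (pow_pos hprime.pos _) this)
      (not_le.mpr (Nat.pow_lt_pow_right hprime.one_lt (Nat.lt_succ_self n')))
  have h3 := orderOf_eq_prime_pow h2 h1
  rw [← h3]
  exact IsPrimitiveRoot.orderOf _

omit [FiniteDimensional (PadicBase F p hp) Ω] in
/-- For every primitive `p^n`-th root of unity `μ` (`n ≥ 1`) there is `g ∈ Gal(Ω/K₀)` with `g ζ = μ`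
(`μ` is a `K₀`-conjugate of `ζ`, `Φ_{p^n}` being irreducible over `K₀`; `Ω` is normal).
[cite: SerreLocalFields1979, Ch. IV §4 Prop. 16 (Gal(ℚ_p(ζ)/ℚ_p) ≅ (ℤ/pⁿ)^×)] -/
theorem exists_gal_apply_zeta_eq {n : ℕ} (hn : 1 ≤ n) {ζΩ : Ω}
    (hζ : (ζΩ : NormedAlgClosure F) = zeta F p n) {μ : NormedAlgClosure F}
    (hμ : IsPrimitiveRoot μ (p ^ n)) :
    ∃ g : Ω ≃ₐ[PadicBase F p hp] Ω, ((g ζΩ : Ω) : NormedAlgClosure F) = μ := by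
  obtain ⟨i, -, hi⟩ := exists_pow_eq_of_pow_eq_one (F := F) (p := p) hμ.pow_eq_one
  have hcop : i.Coprime (p ^ n) := by
    rw [← hi] at hμ
    exact ((zeta_spec F p n).pow_iff_coprime (pow_pos' n) i).mp hμ
  have hcop' : i.Coprime p := (Nat.coprime_pow_right_iff hn i p).mp hcop
  obtain ⟨g₀, hg₀⟩ := exists_smul_zeta_eq_pow hp hn hcop'
  refine ⟨AlgEquiv.restrictNormalHom Ω g₀, ?_⟩
  rw [AlgEquiv.restrictNormalHom_apply, hζ, ← hi, ← hg₀]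
  rfl

/-- **The counting bound.** For `ζ = ζ_{p^n} ∈ Ω`, `H = Stab(ζ)`, and `1 ≤ m`, `m + 1 ≤ n`:
`∏_{q ∈ G/H, q ≠ 1} max ‖q ζ − ζ‖ ‖ζ_{p^{n−m}} − 1‖ ≤ ‖p‖^{m−1}`.  Proof: for `n − m < j < n` and
`ξ` of order `p^j`, the coset of a `g` with `g ζ = ζ ξ` is non-trivial, these cosets are distinct,
and `max ‖ζξ − ζ‖ ‖ζ_{p^{n−m}} − 1‖ = ‖ζ_{p^j} − 1‖`; all other factors are `≤ 1`; and
`∏_{ord ξ = p^j} ‖ζ_{p^j} − 1‖ = ‖ζ_{p^j} − 1‖^{φ(p^j)} = ‖p‖`.  Multiplicative form of the growth of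
the Herbrand sums of `ℚ_p(ζ_{p^n})/ℚ_p` (upper breaks `1, …, n−1`).
[cite: SerreLocalFields1979, Ch. IV §4 Prop. 17–18] -/
theorem prod_erase_max_norm_sub_le {n m : ℕ} (hm : 1 ≤ m) (hmn : m + 1 ≤ n) {ζΩ : Ω}
    (hζ : (ζΩ : NormedAlgClosure F) = zeta F p n) :
    ∏ q ∈ (Finset.univ : Finset ((Ω ≃ₐ[PadicBase F p hp] Ω) ⧸
        MulAction.stabilizer (Ω ≃ₐ[PadicBase F p hp] Ω) ζΩ)).erase
          ((1 : Ω ≃ₐ[PadicBase F p hp] Ω) : (Ω ≃ₐ[PadicBase F p hp] Ω) ⧸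
            MulAction.stabilizer (Ω ≃ₐ[PadicBase F p hp] Ω) ζΩ),
        max ‖((q.out ζΩ : Ω) : NormedAlgClosure F) - ζΩ‖ ‖zeta F p (n - m) - 1‖ ≤
      ‖(p : PadicBase F p hp)‖ ^ (m - 1) := by
  have hprime : p.Prime := Fact.out
  have hn : 1 ≤ n := le_trans (by omega) hmn
  set G := Ω ≃ₐ[PadicBase F p hp] Ω
  set H : Subgroup G := MulAction.stabilizer G ζΩ with hHdef
  set ζ : NormedAlgClosure F := zeta F p n with hζdef
  set U : ℝ := ‖zeta F p (n - m) - 1‖ with hU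
  set f : G ⧸ H → ℝ := fun q => max ‖((q.out ζΩ : Ω) : NormedAlgClosure F) - ζΩ‖ U with hf
  -- the levels and their roots
  set S : Finset (NormedAlgClosure F) :=
    (Finset.Icc (n - m + 1) (n - 1)).biUnion fun j => primitiveRoots (p ^ j) (NormedAlgClosure F)
    with hS
  -- the coset attached to a root of unity `ξ`: that of a `g` with `g ζ = ζ ξ`
  let Φ : NormedAlgClosure F → G ⧸ H := fun ξ =>
    if h : ∃ g : G, ((g ζΩ : Ω) : NormedAlgClosure F) = ζ * ξ then (h.choose : G ⧸ H) else
      ((1 : G) : G ⧸ H)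
  -- value of `q.out ζΩ` on a coset
  have hout : ∀ g : G, (((g : G ⧸ H).out ζΩ : Ω) : NormedAlgClosure F) = ((g ζΩ : Ω) : _) := by
    intro g
    obtain ⟨h, hh⟩ := QuotientGroup.mk_out_eq_mul H g
    rw [hh, AlgEquiv.mul_apply, show (h : G) ζΩ = ζΩ from MulAction.mem_stabilizer_iff.mp h.2]
  -- membership in a level
  have hlevel : ∀ ξ ∈ S, ∃ j, n - m + 1 ≤ j ∧ j ≤ n - 1 ∧ IsPrimitiveRoot ξ (p ^ j) := by
    intro ξ hξ
    rw [hS, Finset.mem_biUnion] at hξ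
    obtain ⟨j, hj, hξj⟩ := hξ
    rw [Finset.mem_Icc] at hj
    exact ⟨j, hj.1, hj.2, (mem_primitiveRoots (pow_pos' j)).mp hξj⟩
  -- for `ξ ∈ S`: the defining `g` exists, `Φ ξ` maps `ζΩ` to `ζ ξ`, is `≠ 1`, and `f (Φ ξ) = ‖ξ − 1‖`
  have hΦ : ∀ ξ ∈ S, (((Φ ξ).out ζΩ : Ω) : NormedAlgClosure F) = ζ * ξ := by
    intro ξ hξ
    obtain ⟨j, hj1, hj2, hξj⟩ := hlevel ξ hξ
    have hex : ∃ g : G, ((g ζΩ : Ω) : NormedAlgClosure F) = ζ * ξ :=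
      exists_gal_apply_zeta_eq hp Ω hn hζ (isPrimitiveRoot_zeta_mul (by omega) (by omega) hξj)
    simp only [Φ, dif_pos hex]
    rw [hout]
    exact hex.choose_spec
  have hΦne : ∀ ξ ∈ S, Φ ξ ≠ ((1 : G) : G ⧸ H) := by
    intro ξ hξ e
    obtain ⟨j, hj1, hj2, hξj⟩ := hlevel ξ hξ
    have h1 := hΦ ξ hξ
    rw [e, hout, AlgEquiv.one_apply, hζ] at h1
    have hξ1 : ξ = 1 := by
      have hζ0 : ζ ≠ 0 := (zeta_spec F p n).ne_zero (pow_pos' n).ne'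
      calc ξ = ζ⁻¹ * (ζ * ξ) := by rw [← mul_assoc, inv_mul_cancel₀ hζ0, one_mul]
        _ = 1 := by rw [← h1, inv_mul_cancel₀ hζ0]
    have := hξj.pow_eq_one_iff_dvd 1 |>.mp (by rw [hξ1, one_pow])
    have h1j : 1 < p ^ j := Nat.one_lt_pow (by omega) hprime.one_lt
    exact absurd (Nat.le_of_dvd one_pos this) (not_le.mpr h1j)
  have hΦinj : Set.InjOn Φ S := by
    intro ξ hξ ξ' hξ' e
    have h1 := hΦ ξ hξ
    have h2 := hΦ ξ' hξ'
    rw [e] at h1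
    have hζ0 : ζ ≠ 0 := (zeta_spec F p n).ne_zero (pow_pos' n).ne'
    exact mul_left_cancel₀ hζ0 (h1.symm.trans h2)
  have hfΦ : ∀ ξ ∈ S, f (Φ ξ) = ‖ξ - 1‖ := by
    intro ξ hξ
    obtain ⟨j, hj1, hj2, hξj⟩ := hlevel ξ hξ
    simp only [f]
    rw [hΦ ξ hξ, hζ, ← mul_sub_one, norm_mul, norm_zeta, one_mul, max_eq_left]
    rw [hU, norm_sub_one_eq_of_isPrimitiveRoot hξj]
    exact norm_zeta_sub_one_mono (by omega)
  -- all factors are in `[0, 1]`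
  have hf0 : ∀ q, 0 ≤ f q := fun q => le_max_of_le_left (norm_nonneg _)
  have hf1 : ∀ q, f q ≤ 1 := by
    intro q
    refine max_le ((norm_sub_le_max' _ _).trans (max_le ?_ ?_)) (norm_zeta_sub_one_le_one _)
    · rw [norm_coe_gal, hζ, norm_zeta]
    · rw [hζ, norm_zeta]
  -- restrict the product to the image of `Φ`
  have himage : S.image Φ ⊆ (Finset.univ : Finset (G ⧸ H)).erase ((1 : G) : G ⧸ H) := by
    intro q hq
    rw [Finset.mem_image] at hq
    obtain ⟨ξ, hξ, rfl⟩ := hq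
    exact Finset.mem_erase.mpr ⟨hΦne ξ hξ, Finset.mem_univ _⟩
  have hsub : ∏ q ∈ (Finset.univ : Finset (G ⧸ H)).erase ((1 : G) : G ⧸ H), f q ≤
      ∏ q ∈ S.image Φ, f q := by
    rw [← Finset.prod_sdiff himage]
    refine mul_le_of_le_one_left (Finset.prod_nonneg fun q _ => hf0 q) ?_
    exact Finset.prod_le_one (fun q _ => hf0 q) (fun q _ => hf1 q)
  refine hsub.trans ?_
  rw [Finset.prod_image hΦinj, Finset.prod_congr rfl hfΦ, hS, Finset.prod_biUnion]
  · -- `∏_{j} ∏_{ord ξ = p^j} ‖ξ − 1‖ = ∏_j ‖p‖ = ‖p‖^{m−1}`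
    have hlev : ∀ j ∈ Finset.Icc (n - m + 1) (n - 1),
        ∏ ξ ∈ primitiveRoots (p ^ j) (NormedAlgClosure F), ‖ξ - 1‖ = ‖(p : PadicBase F p hp)‖ := by
      intro j hj
      rw [Finset.mem_Icc] at hj
      have hj1 : 1 ≤ j := by omega
      rw [Finset.prod_congr rfl (fun ξ hξ => norm_sub_one_eq_of_isPrimitiveRoot
        ((mem_primitiveRoots (pow_pos' j)).mp hξ)), Finset.prod_const,
        (zeta_spec F p j).card_primitiveRoots, norm_zeta_sub_one_pow hj1,
        PadicBase.norm_natCast_closure]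
    rw [Finset.prod_congr rfl hlev, Finset.prod_const, Nat.card_Icc]
    apply le_of_eq
    congr 1
    omega
  · -- the levels are pairwise disjoint
    intro j _ j' _ hjj'
    refine Finset.disjoint_left.mpr fun ξ hξ hξ' => hjj' ?_
    have h1 := (mem_primitiveRoots (pow_pos' j)).mp hξ
    have h2 := (mem_primitiveRoots (pow_pos' j')).mp hξ'
    exact Nat.pow_right_injective hprime.two_le (h1.eq_orderOf.trans h2.eq_orderOf.symm)

end Literature.NumberTheory.PAdicHodge.TateAlmostEtale

end
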